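import Literature.AlgebraicGeometry.ModuliOfAbelianVarieties.SiegelCMReciprocitySimilitude
import Literature.AlgebraicGeometry.ShimuraVarieties.UnitaryShimuraCanonicalModelArtin
import Literature.NumberTheory.ComplexMultiplication.CasselmanTwistIdeleIndependence
import Literature.NumberTheory.GaloisRepresentations.NormResidueSymbolIdentityComponent
import HarnessLib

/-!
# The reciprocity clause (62) of the Siegel canonical model binds EVERY `σ ∈ Aut(ℂ/E)` at every CM special pair
# (non-vacuity of `SiegelRationalModel.IsCanonical`; [Deligne 1971] 3.13/4.21, [Milne ISV] (59)–(62))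

Topic `AlgebraicGeometry/ModuliOfAbelianVarieties`; namespace `Literature.AlgebraicGeometry.ModuliOfAbelianVarieties`.
THEOREMS ONLY (no definition, no named fact, no instance, no `sorry`; net Literature debt **0**).  Sequel of ★ (σ4)-D
`SiegelCanonicalModel` and ★ R60-1 `SiegelCMReciprocitySimilitude`.  Cell hodgecm-mathlib (D-0151), banked GENERIC leaf R60-17 toward
fan-B row I-7 (#60) `SiegelS1` (director g6 RULING s86 (2)(b)); completes the V-S1 reading of point (4) of REF1's pre-audit
(`referees/V-S1-PREAUDIT-ref1.md`: «(62) binds something») from «at the auxiliary pairs» to «at every CM special pair, every `E`, every `σ`».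

WHAT IS PROVED.
* §1 `exists_isArtinCorrespondent_of_traceField_le` — for a CM field `K`, a CM type `Φ`, a number field `E ⊆ ℂ` containing the
  reflex field `E*(Φ) = traceField Φ` and ANY `σ ∈ Aut(ℂ/E)`: some finite idèle `s ∈ 𝔸_{E,f}^×` is an Artin correspondent of `σ`
  (`art_E(s) = σ|_{E^{ab}}`, ★ `UnitaryCanonicalModel.IsArtinCorrespondent`).  [`E ⊇ E*(Φ)` is totally complex (★ `isCMField_traceField`,
  `isTotallyComplex_of_algebra_traceField`); restrict `σ` to `Ē` (★ `exists_absoluteGaloisGroup_restrict`); the norm-residue symbol of a totally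
  complex field is onto from the finite idèles (★ `exists_finiteIdele_absGaloisAbProj_eq_theta_inv`).]  [Milne2005ShimuraVarieties] p. 107: «`art_E`
  is surjective».
* §2 `CMStructure.exists_isArtinCorrespondent_and_gspFinAdelic` — for a CM structure `c` of type `δ`, CM types `Φ`, `E ⊇` every `E*(Φᵢ)`
  (index type inhabited) and ANY `σ ∈ Aut(ℂ/E)`: there are `s` AND `r ∈ GSp_δ(𝔸_{ℚ,f})` with `art_E(s) = σ|` and
  `(r : matrix) = c.cmRecipMatrix Φ E s` (§1 + ★ R60-1 `exists_gspFinAdelic_coe_eq_cmRecipMatrix`) — i.e. BOTH inner binders of the (62)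
  clause of ★ `SiegelRationalModel.IsCanonical` are inhabited for every `σ`.
* §3 HEAD `SiegelRationalModel.IsCanonical.exists_smul_ptQ_eq` — CONSEQUENCE: if `R` is canonical then for every special pair `(c, J, Φ)`,
  every `E ⊇ ∏E*(Φᵢ)`, EVERY `σ ∈ Aut(ℂ/E)`, every principal level `L` and `a ∈ GSp_δ(𝔸_f)` there is `r ∈ GSp_δ(𝔸_f)` (a reciprocity
  element of `σ`) with `σ • [J, a] = [J, r·a]` on the `ℚ`-structure points: Galois moves every CM point inside its CM torus orbit
  ([Milne2005ShimuraVarieties] Thm. 13.6 proof / (62); [Deligne1971TravauxShimura] 3.13) — so (62) as typed DETERMINES the `Aut(ℂ/E)`-action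
  on all CM points, in particular it is never vacuous.
Nothing printed is asserted.  HC_CM is proved only modulo the 7 printed citations until rung 0 closes.

## References
* [Milne2005ShimuraVarieties] J. S. Milne, *Introduction to Shimura varieties* (2005), (59) p. 107 («art_E … surjective»), Def. 12.8 (62) p. 114,
  Thm. 13.6 p. 118.
* [Deligne1971TravauxShimura] P. Deligne, *Travaux de Shimura*, Sém. Bourbaki 389 (1971), Déf. 3.13 p. 141, 4.18 p. 150, Thm. 4.21 p. 152.
* [Shimura1998] G. Shimura, *Abelian Varieties with Complex Multiplication and Modular Functions* (1998), §8.3 Prop. 28 (`K*` is CM).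
* [CasselsFrohlichANT1967] Cassels–Fröhlich, Ch. VII §5 (norm-residue symbol surjective onto `Gal(K^{ab}/K)` for totally complex `K`).
-/

set_option autoImplicit false

noncomputable section

open Matrix NumberField IsDedekindDomain

namespace Literature.AlgebraicGeometry.ModuliOfAbelianVarieties

open Literature.AlgebraicGeometry.Motives (CMType)
open Literature.NumberTheory.ComplexMultiplication (traceField isTotallyComplex_of_algebra_traceField)
open Literature.NumberTheory.GaloisRepresentations (exists_finiteIdele_absGaloisAbProj_eq_theta_inv)
open Literature.AlgebraicGeometry.ShimuraVarieties (UnitaryCanonicalModel.IsArtinCorrespondent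
  UnitaryCanonicalModel.exists_absoluteGaloisGroup_restrict)

/-! ### §1. Every `σ ∈ Aut(ℂ/E)` has an Artin-correspondent finite idèle, for `E ⊇ E*(Φ)` -/

/-- **`art_E` is onto: every `σ ∈ Aut(ℂ/E)` has an Artin-correspondent finite idèle of `E`**, for any number field `E ⊆ ℂ`
containing the reflex field `E*(Φ)` of a CM type of a CM field (`E` is then totally complex, so the norm-residue symbol restricted to
the finite idèles is onto `Gal(E^{ab}/E)`). [cite: Milne2005ShimuraVarieties, (59) p. 107 («art_E is surjective»)]
[cite: CasselsFrohlichANT1967, Ch. VII §5] [cite: Shimura1998, §8.3 Prop. 28] -/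
theorem exists_isArtinCorrespondent_of_traceField_le {K : Type} [Field K] [NumberField K] [IsCMField K] (Φ : CMType K)
    (E : IntermediateField ℚ ℂ) [NumberField ↥E] (hE : traceField Φ ≤ E) (σ : ℂ ≃ₐ[↥E] ℂ) :
    ∃ s : (FiniteAdeleRing (𝓞 ↥E) ↥E)ˣ,
      UnitaryCanonicalModel.IsArtinCorrespondent ↥E (algebraMap ↥E ℂ) s σ.toRingEquiv := by
  letI : Algebra ↥(traceField Φ) ↥E := (IntermediateField.inclusion hE).toRingHom.toAlgebra
  haveI : IsTotallyComplex ↥E := isTotallyComplex_of_algebra_traceField K Φ (k := ↥E)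
  obtain ⟨e, γ, he⟩ := UnitaryCanonicalModel.exists_absoluteGaloisGroup_restrict ↥E (algebraMap ↥E ℂ) σ.toRingEquiv
    fun x => σ.commutes x
  obtain ⟨s, hs⟩ := exists_finiteIdele_absGaloisAbProj_eq_theta_inv γ
  exact ⟨s, e, γ, he, hs⟩

/-! ### §2. Both inner binders of (62) are inhabited for every `σ` -/

namespace CMStructure

variable {g : ℕ} {δ : Fin g → ℕ} {ι : Type} [Fintype ι] [DecidableEq ι] {K : ι → Type} [∀ i, Field (K i)]
  [∀ i, NumberField (K i)] [∀ i, IsCMField (K i)] (c : CMStructure g δ ι K)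

/-- **For every `σ ∈ Aut(ℂ/E)` there are an Artin correspondent `s` and a reciprocity element `r ∈ GSp_δ(𝔸_{ℚ,f})` with
`(r : matrix) = c.cmRecipMatrix Φ E s`** (`E ⊇` every `E*(Φᵢ)`, index type inhabited): §1 at the factor `i₀` and ★ R60-1
`exists_gspFinAdelic_coe_eq_cmRecipMatrix`. [cite: Milne2005ShimuraVarieties, (59) p. 107 and Def. 12.8 (60)–(62) p. 114]
[cite: Deligne1971TravauxShimura, 3.9 p. 140, 4.18 p. 150] -/
theorem exists_isArtinCorrespondent_and_gspFinAdelic (Φ : ∀ i, CMType (K i)) (E : IntermediateField ℚ ℂ) [NumberField ↥E]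
    (hE : ∀ i, traceField (Φ i) ≤ E) (i₀ : ι) (σ : ℂ ≃ₐ[↥E] ℂ) :
    ∃ (s : (FiniteAdeleRing (𝓞 ↥E) ↥E)ˣ) (r : gspFinAdelic δ),
      UnitaryCanonicalModel.IsArtinCorrespondent ↥E (algebraMap ↥E ℂ) s σ.toRingEquiv ∧
        ((r : GL (Fin g ⊕ Fin g) finAdeleQ) : Matrix (Fin g ⊕ Fin g) (Fin g ⊕ Fin g) finAdeleQ) = c.cmRecipMatrix Φ E s := by
  obtain ⟨s, hs⟩ := exists_isArtinCorrespondent_of_traceField_le (Φ i₀) E (hE i₀) σ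
  obtain ⟨r, hr⟩ := c.exists_gspFinAdelic_coe_eq_cmRecipMatrix' Φ E hE s
  exact ⟨s, r, hs, hr⟩

end CMStructure

/-! ### §3. Consequence: a canonical model's Galois action moves every CM point inside its torus orbit -/

namespace SiegelRationalModel

variable {g : ℕ} {δ : Fin g → ℕ} {Sg : SiegelComplexRecordSystem g δ} {R : SiegelRationalModel g δ Sg}

/-- **HEAD — under `IsCanonical`, EVERY `σ ∈ Aut(ℂ/E)` moves the CM point `[J, a]` to `[J, r·a]` for SOME reciprocity element
`r ∈ GSp_δ(𝔸_{ℚ,f})` of `σ`** (for every CM special pair `(c, J, Φ)` with inhabited index type, every number field `E ⊇ ∏E*(Φᵢ)`,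
every principal level and every `a`): the (62) clause of ★ `SiegelRationalModel.IsCanonical` applied at the `(s, r)` of
`CMStructure.exists_isArtinCorrespondent_and_gspFinAdelic`.  So the typed reciprocity law DETERMINES the `Aut(ℂ/E)`-action on all CM points
and is never vacuous ([Milne2005ShimuraVarieties] proof of Thm. 13.6: «`σ[x,a] = [x, r_x(s)·a]` … for all `σ` fixing `E`»).
[cite: Milne2005ShimuraVarieties, Def. 12.8 (62) p. 114 and Thm. 13.6 p. 118] [cite: Deligne1971TravauxShimura, Déf. 3.13 p. 141, Thm. 4.21 p. 152] -/
theorem IsCanonical.exists_smul_ptQ_eq (hR : R.IsCanonical) {ι : Type} [Fintype ι] [DecidableEq ι] {K : ι → Type}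
    [∀ i, Field (K i)] [∀ i, NumberField (K i)] [∀ i, IsCMField (K i)] (c : CMStructure g δ ι K) (J : C0pm δ)
    (Φ : ∀ i, CMType (K i)) (hsp : c.IsSpecial J Φ) (E : IntermediateField ℚ ℂ) [FiniteDimensional ℚ ↥E]
    (hE : ∀ i, traceField (Φ i) ≤ E) (i₀ : ι) :
    haveI : NumberField ↥E := NumberField.mk
    ∀ (σ : ℂ ≃ₐ[↥E] ℂ) (L : SiegelLevel δ) (a : gspFinAdelic δ), ∃ r : gspFinAdelic δ,
      (σ.restrictScalars ℚ) • R.ptQ L ((Sg.pts L).symm (SiegelShimuraSet.mk δ L.1 J a)) =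
        R.ptQ L ((Sg.pts L).symm (SiegelShimuraSet.mk δ L.1 J (r * a))) := by
  haveI : NumberField ↥E := NumberField.mk
  intro σ L a
  obtain ⟨s, r, hs, hr⟩ := c.exists_isArtinCorrespondent_and_gspFinAdelic Φ E hE i₀ σ
  exact ⟨r, hR ι K c J Φ hsp E hE σ s hs r hr L a⟩

end SiegelRationalModel

end Literature.AlgebraicGeometry.ModuliOfAbelianVarieties

end
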